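import Summits.BirchSwinnertonDyer.Rank1Residual.GaloisImage.SmallImageAbelianInertia
import HarnessLib

/-!
# Small (irreducible, non-surjective) mod-`p` image ⟹ TAME, inertia-SPLIT `E[p]` at `p`:
# the O8 sub-partition key `InertiaSplitAt` is a THEOREM on every ordinary-type row — part 2
# (cell `b2b-bsdres`, lane CLASS-CLOSURE, seat cc-typer-1 = typer of record N11 / O8; prover task
# "O8-TAME" of `class-closure/O8/STATEMENT.md` §12, typed and discharged here; joint small-image axis
# O8 / N2 = X10b@3 / N3 = X9@{5,7})

HONEST FRAMING (cell `b2b-bsdres`, run/shared/lean/b2b/bsd-rank1-residual/, verbatim in every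
file): the goal of the cell is to DELETE the COMBINATION-SHAPED residual classes of the
Birch–Swinnerton-Dyer formula for ALL analytic-rank `≤ 1` elliptic curves over `ℚ` — "full BSD
formula for every rank `≤ 1` curve in class `C`" assembled STRICTLY from published theorems — so
that the rank-`≤ 1` remainder becomes exactly the CONSTRUCTION-SHAPED classes, which are TYPED
(missing-input `Prop`s), NOT attempted. This is not "finishing BSD". Lane CLASS-CLOSURE: research
routes, no claim beyond the stated classes; census output = EVIDENCE, never a Literature fact;
NOTHING is booked here. This file contains THEOREMS ONLY (finite group theory of the image of
`ρ̄_{E,p}` and linear algebra on the `𝔽_p`-plane `E[p]`, over tree predicates); no definition, no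
named fact, no conjecture, no `sorry`.

## What is proved (experiment type (2) OBSTRUCTION ANATOMY → SUB-PARTITION, class O8; and the
## joint small-image axis O8 / N2 / N3 of CLASS-CLOSURE-PLAN §3.6 / §3.16)

Write `ρ̄ = ρ̄_{E,p} : Γ_ℚ → Aut(E[p])`, `G = ρ̄(Γ_ℚ)`. On the small-image classes (O8 =
`ClassX4 W p ∧ ¬ Surj W p`; N2 = X10b = `ClassX10 W 3 ∧ ¬ Surj W 3`; N3 = X9 = `ClassX9 W p`) the
image is IRREDUCIBLE and PROPER, and `det G = 𝔽_pˣ` over `ℚ`; Serre's Prop. 15 read backwards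
(tree: `WeierstrassCurve.not_dvd_card_of_not_hasSurjectiveModNGaloisRep`) gives `p ∤ #G`.

* Prequel `GaloisImage/SmallImageAbelianInertia.lean` (same seat): NO unipotent Galois element on
  `E[p]` (`smul_eq_self_of_unipotent_of_irr_of_not_surj`, `…_of_fix_line_…`) and the image of any
  line-stabilising subgroup `I ≤ Γ_ℚ` is ABELIAN (`smul_comm_of_stableLine_of_irr_of_not_surj`),
  plus the line lemmas used below.
* `inertiaSplitAt_of_twistedOrdinaryLineAt_of_irr_of_not_surj` — **twisted-ordinary shape ⟹
  split**: if `E[p]|_I ≅ (1 ∗; 0 χ)` with `χ ≠ 1` (`TwistedOrdinaryLineAt W p I`: the ADDITIVE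
  potentially ordinary / potentially multiplicative rows of inertial type `θ = ω`, i.e. EVERY (M) and
  `I₀*` row of N10 / N11 / O8 at `p = 3`), then `E[p]|_I = X ⊕ L ≅ χ ⊕ 1` (`InertiaSplitAt W p I`):
  `X` = the `χ(σ₀)`-eigenline of one `σ₀ ∈ I` with `χ(σ₀) ≠ 1`, `I`-stable by commutativity.
* `inertiaSplitAt_of_unramifiedQuotientLineAt_of_irr_of_not_surj` — **unramified-quotient shape ⟹
  split**: if `E[p]|_I ≅ (χ ∗; 0 1)` (`UnramifiedQuotientLineAt W p I`: GOOD ORDINARY and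
  MULTIPLICATIVE primes, tree `unramifiedQuotientLineAt_of_goodOrdinary` /
  `exists_unramifiedQuotientLineAt_of_multiplicative`), then `E[p]|_I = X ⊕ Y ≅ χ ⊕ 1` as well
  (`Y` = the fixed line of a `σ₀` with `χ(σ₀) ≠ 1`, or any complement if `I` acts trivially).
* Class forms: `Additive.O8.inertiaSplitAt_of_twistedOrdinaryLineAt` (O8),
  `ClassX9.inertiaSplitAt` (N3 = X9, good ordinary `p ≥ 5`), `ClassX10.inertiaSplitAt_of_not_surj`
  (N2 = X10b, good ordinary `p = 3`) — the last two with NO per-pair binder (the unramified-quotient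
  line is x1a's Serre §1.11 line at a good ordinary prime of a globally minimal model), and
  `exists_inertiaSplitAt_of_multiplicative_of_irr_of_not_surj` (X2's Tate line, granted A40/A41).

READING (class-closure, O8 §12 / N11 SUBPARTITION-typed v1.2 row TAME): the census finding
"O8 ⊆ TAME at 3: 244 / 244 (M)/G-ord rows" (`class-closure/N11/TAME3-census-typer1.tsv`) is a
THEOREM modulo the per-pair shape binder `TwistedOrdinaryLineAt W 3 I_𝔓` (task TB-TOL: discharge
from `E = E♭ ⊗ χ₋₃`, not done here); on N2 / N3 it is a theorem outright. Consequence for the joint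
small-image ideation target (O8 / N2 / N3, `class-closure/O8/STATEMENT.md` §4): at the prime `p`
of small image, `ρ̄|_{I_p} ≅ χ ⊕ 1` is SEMISIMPLE with a TRIVIAL constituent on every
ordinary-type row — BOTH `p`-stabilisations of `ρ̄` exist (the companion-form situation of
Gross 1990 / Coleman–Voloch 1992, Edixhoven 1997 §4.2), and the inertia image is abelian of order
prime to `p`. What this does NOT say: nothing about potentially supersingular small-image rows
(there `ρ̄|_{I_p}` may be irreducible over `𝔽_p`: level-2 fundamental characters), and nothing
about BSD_p — O8 / N2 / N3 stay OPEN; nothing is booked.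

References: J.-P. Serre, Invent. Math. 15 (1972) §2.4 Prop. 15, §1.11 Prop. 11 [Serre1972];
B. Edixhoven, in Cornell–Silverman–Stevens (1997) §4.2 [Edixhoven1997Serre]; B. H. Gross, Duke
Math. J. 61 (1990) §0; class-closure/O8/STATEMENT.md §§11–12; class-closure/N11/SUBPARTITION-typed.md
v1.2; Summits `Additive/MixedCongruenceTameness.lean` (p258175).
-/

set_option autoImplicit false

noncomputable section

open scoped Classical

open WeierstrassCurve Literature.NumberTheory.EllipticCurves Literature.NumberTheory.GaloisRepresentations
  Field IsDedekindDomain NumberField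
  Literature.NumberTheory.EllipticCurves.Rank1Residual
  Summit.BirchSwinnertonDyer.Rank1Residual.Additive.MixedCongruence

namespace Summit.BirchSwinnertonDyer.Rank1Residual.GaloisImage

variable {W : WeierstrassCurve ℚ} [W.IsElliptic] {p : ℕ} [Fact p.Prime]

/-! ## §3. Ordinary-type shapes split on inertia in a small image -/

variable (W p) in
/-- **Twisted-ordinary shape ⟹ inertia-split (O8-TAME).** Under `Irr W p ∧ ¬ Surj W p`, if
`E[p]` has twisted-ordinary shape at `I ≤ Γ_ℚ` — a line `L` FIXED pointwise by `I` with `I`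
non-trivial on `E[p]/L`, i.e. `E[p]|_I ≅ (1 ∗; 0 χ)`, `χ ≠ 1`: the shape of EVERY additive
potentially ordinary / potentially multiplicative prime of inertial type `ω` ((M) and `I₀*` rows
at `p = 3`) — then `E[p]|_I = X ⊕ L` SPLITS with `X` an `I`-stable line (`≅ χ ⊕ 1`, tame):
`X` is the `χ(σ₀)`-eigenline of any `σ₀ ∈ I` with `χ(σ₀) ≠ 1`, stable under `I` because the image
of `I` is abelian (`smul_comm_of_stableLine_of_irr_of_not_surj`). Census: O8 244/244 (M)/G-ord rows
at `3` are TAME (`class-closure/N11/TAME3-census-typer1.tsv`); this is the theorem behind it,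
modulo the per-pair shape binder. [cite: Serre1972, §2.4 Prop. 15]
[cite: Edixhoven1997Serre, §4.2 (PDF p. 297; ρ|_{I_p} a direct sum of two distinct powers of χ_p)] -/
theorem inertiaSplitAt_of_twistedOrdinaryLineAt_of_irr_of_not_surj (hirr : Irr W p)
    (hns : ¬ Surj W p) {I : Subgroup (absoluteGaloisGroup ℚ)} (hE : TwistedOrdinaryLineAt W p I) :
    InertiaSplitAt W p I := by
  have hp : p.Prime := Fact.out
  obtain ⟨L, hL, hfix, σ₀, hσ₀, Q₀, hQ₀⟩ := hE
  have hst : ∀ σ ∈ I, ∀ P ∈ L, σ • P ∈ L := fun σ hσ P hP ↦ by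
    rw [hfix σ hσ P hP]; exact hP
  -- the scalar `a₀` of `σ₀` on `E[p]/L`; `a₀ ≢ 1 (mod p)`
  obtain ⟨a₀, ha₀⟩ := exists_int_forall_smul_sub_zsmul_mem hL (hst σ₀ hσ₀)
  have ha₀1 : ((a₀ - 1 : ℤ) : ZMod p) ≠ 0 := by
    intro h0
    obtain ⟨m, hm⟩ := (ZMod.intCast_zmod_eq_zero_iff_dvd _ p).mp h0
    apply hQ₀
    have h1 : σ₀ • Q₀ - Q₀ = (σ₀ • Q₀ - a₀ • Q₀) + m • ((p : ℤ) • Q₀) := by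
      rw [smul_smul, show m * (p : ℤ) = a₀ - 1 by linarith]
      generalize σ₀ • Q₀ = t
      module
    rw [h1, natCast_zsmul_eq_zero, smul_zero, add_zero]
    exact ha₀ Q₀
  have hQ₀L : Q₀ ∉ L := fun h ↦ hQ₀ (L.sub_mem (hst σ₀ hσ₀ Q₀ h) h)
  -- the `a₀`-eigenline `X` of `σ₀`
  obtain ⟨X, hX⟩ := exists_eigenAddSubgroup (W := W) (p := p) σ₀ a₀
  -- an eigenvector outside `L`: `P₁ = (a₀ - 1) • Q₀ + y₀`, `y₀ = σ₀ Q₀ - a₀ Q₀ ∈ L`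
  obtain ⟨y₀, hy₀⟩ : ∃ y₀, y₀ = σ₀ • Q₀ - a₀ • Q₀ := ⟨_, rfl⟩
  have hy₀L : y₀ ∈ L := hy₀ ▸ ha₀ Q₀
  have hσQ₀ : σ₀ • Q₀ = y₀ + a₀ • Q₀ := by rw [hy₀, sub_add_cancel]
  obtain ⟨P₁, hP₁⟩ : ∃ P₁, P₁ = (a₀ - 1) • Q₀ + y₀ := ⟨_, rfl⟩
  have hP₁X : P₁ ∈ X := by
    rw [hX, hP₁, smul_add, hfix σ₀ hσ₀ y₀ hy₀L, smul_comm σ₀ (a₀ - 1) Q₀, hσQ₀]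
    module
  have hP₁L : P₁ ∉ L := by
    intro h
    apply hQ₀L
    have h2 : (a₀ - 1) • Q₀ ∈ L := by
      have h3 := L.sub_mem h hy₀L
      rwa [hP₁, add_sub_cancel_right] at h3
    exact mem_of_zsmul_mem ha₀1 h2
  have hXbot : X ≠ ⊥ := by
    intro h
    apply hP₁L
    have h0 : P₁ = 0 := by rw [← AddSubgroup.mem_bot, ← h]; exact hP₁X
    rw [h0]
    exact L.zero_mem
  -- `X ⊓ L = ⊥`
  have hXL : X ⊓ L = ⊥ := by
    rw [eq_bot_iff]
    intro P hP
    rw [AddSubgroup.mem_inf] at hP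
    rw [AddSubgroup.mem_bot]
    apply eq_zero_of_zsmul_eq_zero ha₀1
    rw [sub_smul, one_smul, ← (hX P).mp hP.1, hfix σ₀ hσ₀ P hP.2, sub_self]
  have hXcard : Nat.card X = p := natCard_eq_of_ne_bot_of_inf_eq_bot hXbot hL hXL
  have hne : X ≠ L := by
    intro h
    rw [h, inf_idem] at hXL
    have h1 : Nat.card L = 1 := by rw [hXL]; exact AddSubgroup.card_bot
    exact hp.one_lt.ne' (hL.symm.trans h1)
  refine ⟨X, L, hXcard, hL, hXL, sup_eq_top_of_ne (Literature.NumberTheory.EllipticCurves.natCard_geomTorsion W p) hXcard hL hne,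
    ?_, hfix⟩
  -- `X` is `I`-stable: `σ₀ (τ P) = τ (σ₀ P) = τ (a₀ P) = a₀ (τ P)`
  intro τ hτ P hP
  rw [hX] at hP ⊢
  rw [smul_comm_of_stableLine_of_irr_of_not_surj W p hirr hns hL hst hσ₀ hτ P, hP,
    smul_comm τ a₀ P]

variable (W p) in
/-- **Unramified-quotient shape ⟹ inertia-split (the N2 / N3 twin).** Under `Irr W p ∧ ¬ Surj W p`,
if `E[p]` has unramified-quotient shape at `I ≤ Γ_ℚ` — a line `X` with `(σ − 1)E[p] ⊆ X` for
`σ ∈ I`, i.e. `E[p]|_I ≅ (χ ∗; 0 1)`: GOOD ORDINARY and MULTIPLICATIVE primes — then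
`E[p]|_I = X ⊕ Y` SPLITS with `Y` FIXED pointwise by `I`: if `I` fixes `X` pointwise it is
unipotent, hence trivial on `E[p]` (`smul_eq_self_of_fix_line_of_irr_of_not_surj`) and any
complement serves; otherwise `Y` is the fixed line of a `σ₀ ∈ I` with `χ(σ₀) ≠ 1`, `I`-stable by
commutativity and then `I`-fixed since `(τ − 1)Y ⊆ X ⊓ Y = 0`. [cite: Serre1972, §2.4 Prop. 15]
[cite: Edixhoven1997Serre, §4.2 (PDF p. 297; ρ|_{I_p} a direct sum of two distinct powers of χ_p)] -/
theorem inertiaSplitAt_of_unramifiedQuotientLineAt_of_irr_of_not_surj (hirr : Irr W p)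
    (hns : ¬ Surj W p) {I : Subgroup (absoluteGaloisGroup ℚ)} (hA : UnramifiedQuotientLineAt W p I) :
    InertiaSplitAt W p I := by
  have hp : p.Prime := Fact.out
  obtain ⟨X, hX, hXsub⟩ := hA
  have hst : ∀ σ ∈ I, ∀ P ∈ X, σ • P ∈ X := fun σ hσ P hP ↦ by
    have h : σ • P = (σ • P - P) + P := by abel
    rw [h]
    exact X.add_mem (hXsub σ hσ P) hP
  by_cases htriv : ∀ σ ∈ I, ∀ P ∈ X, σ • P = P
  · -- `I` is unipotent, hence acts trivially on `E[p]`: any complement `Y` of `X` is fixed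
    have hall : ∀ σ ∈ I, ∀ P : geomTorsion W (p : ℤ), σ • P = P := fun σ hσ ↦
      smul_eq_self_of_fix_line_of_irr_of_not_surj W p hirr hns (htriv σ hσ) (hXsub σ hσ)
    obtain ⟨Q₀, hQ₀⟩ := exists_not_mem_of_natCard_eq hX
    have hQ₀0 : Q₀ ≠ 0 := fun h ↦ hQ₀ (h ▸ X.zero_mem)
    have hord : addOrderOf Q₀ = p :=
      addOrderOf_eq_prime (by rw [← natCast_zsmul]; exact natCast_zsmul_eq_zero Q₀) hQ₀0
    have hY : Nat.card (AddSubgroup.zmultiples Q₀) = p := by rw [Nat.card_zmultiples, hord]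
    have hne : X ≠ AddSubgroup.zmultiples Q₀ := fun h ↦ hQ₀ (h ▸ AddSubgroup.mem_zmultiples Q₀)
    exact ⟨X, AddSubgroup.zmultiples Q₀, hX, hY, (line_eq_or_inf_eq_bot hX hY).resolve_left hne,
      sup_eq_top_of_ne (Literature.NumberTheory.EllipticCurves.natCard_geomTorsion W p) hX hY hne, hst,
      fun σ hσ P _ ↦ hall σ hσ P⟩
  · push Not at htriv
    obtain ⟨σ₀, hσ₀, P₀, hP₀X, hP₀⟩ := htriv
    -- the scalar `c₀` of `σ₀` on `X`; `c₀ ≢ 1 (mod p)`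
    obtain ⟨c₀, hc₀⟩ := exists_int_forall_mem_smul_eq_zsmul hX (hst σ₀ hσ₀)
    have hc₀1 : ((c₀ - 1 : ℤ) : ZMod p) ≠ 0 := by
      intro h0
      obtain ⟨m, hm⟩ := (ZMod.intCast_zmod_eq_zero_iff_dvd _ p).mp h0
      apply hP₀
      have h1 : c₀ • P₀ = P₀ + m • ((p : ℤ) • P₀) := by
        rw [smul_smul, show m * (p : ℤ) = c₀ - 1 by linarith]
        module
      rw [hc₀ P₀ hP₀X, h1, natCast_zsmul_eq_zero, smul_zero, add_zero]
    -- the fixed line `Y` of `σ₀` (its `1`-eigenspace)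
    obtain ⟨Y, hY1⟩ := exists_eigenAddSubgroup (W := W) (p := p) σ₀ 1
    have hY : ∀ P, P ∈ Y ↔ σ₀ • P = P := fun P ↦ by rw [hY1, one_smul]
    -- a fixed vector outside `X`: `P₁ = (c₀ - 1) • Q₀ - x₀`, `x₀ = σ₀ Q₀ - Q₀ ∈ X`
    obtain ⟨Q₀, hQ₀⟩ := exists_not_mem_of_natCard_eq hX
    obtain ⟨x₀, hx₀⟩ : ∃ x₀, x₀ = σ₀ • Q₀ - Q₀ := ⟨_, rfl⟩
    have hx₀X : x₀ ∈ X := hx₀ ▸ hXsub σ₀ hσ₀ Q₀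
    have hσQ₀ : σ₀ • Q₀ = x₀ + Q₀ := by rw [hx₀, sub_add_cancel]
    obtain ⟨P₁, hP₁⟩ : ∃ P₁, P₁ = (c₀ - 1) • Q₀ - x₀ := ⟨_, rfl⟩
    have hP₁Y : P₁ ∈ Y := by
      rw [hY, hP₁, smul_sub, hc₀ x₀ hx₀X, smul_comm σ₀ (c₀ - 1) Q₀, hσQ₀]
      module
    have hP₁X : P₁ ∉ X := by
      intro h
      apply hQ₀
      have h2 : (c₀ - 1) • Q₀ ∈ X := by
        have h3 := X.add_mem h hx₀X
        rwa [hP₁, sub_add_cancel] at h3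
      exact mem_of_zsmul_mem hc₀1 h2
    have hYbot : Y ≠ ⊥ := by
      intro h
      apply hP₁X
      have h0 : P₁ = 0 := by rw [← AddSubgroup.mem_bot, ← h]; exact hP₁Y
      rw [h0]
      exact X.zero_mem
    -- `Y ⊓ X = ⊥`
    have hYX : Y ⊓ X = ⊥ := by
      rw [eq_bot_iff]
      intro P hP
      rw [AddSubgroup.mem_inf] at hP
      rw [AddSubgroup.mem_bot]
      apply eq_zero_of_zsmul_eq_zero hc₀1
      rw [sub_smul, one_smul, ← hc₀ P hP.2, (hY P).mp hP.1, sub_self]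
    have hYcard : Nat.card Y = p := natCard_eq_of_ne_bot_of_inf_eq_bot hYbot hX hYX
    have hne : X ≠ Y := by
      intro h
      rw [h, inf_idem] at hYX
      have h1 : Nat.card Y = 1 := by rw [hYX]; exact AddSubgroup.card_bot
      exact hp.one_lt.ne' (hYcard.symm.trans h1)
    -- `Y` is `I`-stable (commutativity), hence `I`-fixed: `(τ − 1)Y ⊆ X ⊓ Y = 0`
    have hYst : ∀ τ ∈ I, ∀ P ∈ Y, τ • P ∈ Y := by
      intro τ hτ P hP
      rw [hY] at hP ⊢
      rw [smul_comm_of_stableLine_of_irr_of_not_surj W p hirr hns hX hst hσ₀ hτ P, hP]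
    refine ⟨X, Y, hX, hYcard, by rwa [inf_comm] at hYX,
      sup_eq_top_of_ne (Literature.NumberTheory.EllipticCurves.natCard_geomTorsion W p) hX hYcard hne, hst, ?_⟩
    intro τ hτ P hP
    have hd : τ • P - P ∈ Y ⊓ X :=
      AddSubgroup.mem_inf.mpr ⟨Y.sub_mem (hYst τ hτ P hP) hP, hXsub τ hτ P⟩
    rw [hYX, AddSubgroup.mem_bot, sub_eq_zero] at hd
    exact hd

/-! ## §4. Class forms: O8 (additive, per-pair shape binder), N3 = X9 and N2 = X10b (good
ordinary: no binder), multiplicative small-image primes (X2's Tate line) -/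

variable (W p) in
/-- **Good ordinary small-image prime ⟹ `E[p]|_{I_𝔓}` split**, at every inertia group above `p`
(`p` odd, globally minimal model): x1a's Serre §1.11 line is an unramified-quotient line
(`unramifiedQuotientLineAt_of_goodOrdinary`). [cite: Serre1972, §1.11 Prop. 11 and §2.4 Prop. 15] -/
theorem inertiaSplitAt_of_goodOrdinary_of_irr_of_not_surj [W.IsGloballyMinimal] (hp2 : p ≠ 2)
    (hgood : W.HasGoodReductionAtPrime p) (hord : ¬ (p : ℤ) ∣ W.frobeniusTrace p)
    (hirr : Irr W p) (hns : ¬ Surj W p)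
    {v : HeightOneSpectrum (𝓞 ℚ)} (hv : (p : 𝓞 ℚ) ∈ v.asIdeal)
    {𝔓 : Ideal (absIntegers (𝓞 ℚ) ℚ)} (h𝔓 : 𝔓 ∈ v.primesAbove) :
    InertiaSplitAt W p (𝔓.inertia (absoluteGaloisGroup ℚ)) :=
  inertiaSplitAt_of_unramifiedQuotientLineAt_of_irr_of_not_surj W p hirr hns
    (unramifiedQuotientLineAt_of_goodOrdinary hp2 hgood hord hv h𝔓)

variable (W p) in
/-- **N3 = class X9 (non-CM, good ordinary `p ≥ 5`, `E[p]` irreducible, `ρ̄` not onto) ⟹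
`E[p]|_{I_𝔓} ≅ χ ⊕ 1` split** at every inertia group above `p`: the residually-small image is
TAMELY ramified at `p` with a trivial constituent, so BOTH `p`-stabilisations of `ρ̄` exist (joint
small-image axis O8 / N2 / N3). No per-pair binder. [cite: Serre1972, §1.11 Prop. 11 and §2.4 Prop. 15] -/
theorem ClassX9.inertiaSplitAt [W.IsGloballyMinimal] (h : ClassX9 W p)
    {v : HeightOneSpectrum (𝓞 ℚ)} (hv : (p : 𝓞 ℚ) ∈ v.asIdeal)
    {𝔓 : Ideal (absIntegers (𝓞 ℚ) ℚ)} (h𝔓 : 𝔓 ∈ v.primesAbove) :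
    InertiaSplitAt W p (𝔓.inertia (absoluteGaloisGroup ℚ)) :=
  inertiaSplitAt_of_goodOrdinary_of_irr_of_not_surj W p (by have := h.2.2.1; omega) h.2.1.1
    h.2.1.2 h.2.2.2.1 h.2.2.2.2.1 hv h𝔓

variable (W p) in
/-- **N2 = X10b (class X10 with `ρ̄_{E,3}` not onto: `3` good ordinary, `E[3]` irreducible) ⟹
`E[3]|_{I_𝔓} ≅ χ ⊕ 1` split** at every inertia group above `3`. No per-pair binder.
[cite: Serre1972, §1.11 Prop. 11 and §2.4 Prop. 15] -/
theorem ClassX10.inertiaSplitAt_of_not_surj [W.IsGloballyMinimal] (h : ClassX10 W p)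
    (hns : ¬ Surj W 3) {v : HeightOneSpectrum (𝓞 ℚ)} (hv : (3 : 𝓞 ℚ) ∈ v.asIdeal)
    {𝔓 : Ideal (absIntegers (𝓞 ℚ) ℚ)} (h𝔓 : 𝔓 ∈ v.primesAbove) :
    InertiaSplitAt W 3 (𝔓.inertia (absoluteGaloisGroup ℚ)) :=
  inertiaSplitAt_of_goodOrdinary_of_irr_of_not_surj W 3 (by decide) h.2.1.1 h.2.1.2 h.2.2.1 hns
    (by exact_mod_cast hv) h𝔓

variable (W p) in
/-- **Multiplicative small-image prime ⟹ `E[p]|_{I_𝔓}` split** at the inertia group of the tree's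
chosen prime above `p` (X2's Tate line `C[p] ≅ μ_p`, granted Tate uniformisation A40/A41): with
`exists_stable_complement_of_inertiaSplitAt` the Tate extension class is trivial on inertia mod
`p` (`q ∈ (ℚ_p^{nr×})^p`, census key `TatePthPowerKey`).
[cite: SilvermanATAEC1994, V.5.3 and V.5.4 (Tate uniformisation)] [cite: Serre1972, §2.4 Prop. 15] -/
theorem exists_inertiaSplitAt_of_multiplicative_of_irr_of_not_surj [W.IsGloballyMinimal]
    (hT : Silverman1994_thmV53_tateUniformisation.{0})
    (hT' : Silverman1994_thmV53_corV54_tateUniformisation.{0})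
    (hp2 : p ≠ 2) (hmult : W.HasMultiplicativeReductionAtPrime p) (hirr : Irr W p)
    (hns : ¬ Surj W p) :
    ∃ (v : HeightOneSpectrum (𝓞 ℚ)), (p : 𝓞 ℚ) ∈ v.asIdeal ∧ ∃ 𝔓 ∈ v.primesAbove,
      InertiaSplitAt W p (𝔓.inertia (absoluteGaloisGroup ℚ)) := by
  obtain ⟨v, hv, 𝔓, h𝔓, hA⟩ := exists_unramifiedQuotientLineAt_of_multiplicative hT hT' hp2 hmult
  exact ⟨v, hv, 𝔓, h𝔓, inertiaSplitAt_of_unramifiedQuotientLineAt_of_irr_of_not_surj W p hirr hns hA⟩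

end Summit.BirchSwinnertonDyer.Rank1Residual.GaloisImage

/-! ## §5. O8 forms (namespace `Additive`, hypotheses `ClassX4 W p`, `¬ Surj W p`) -/

namespace Summit.BirchSwinnertonDyer.Rank1Residual.Additive

open Summit.BirchSwinnertonDyer.Rank1Residual.GaloisImage

variable (W : WeierstrassCurve ℚ) [W.IsElliptic] (p : ℕ) [Fact p.Prime]

/-- **O8 ⟹ no unipotent Galois element on `E[p]`.** On an O8 pair (`ClassX4 W p`, `¬ Surj W p`)
every `τ ∈ Γ_ℚ` fixing a line of `E[p]` pointwise and acting trivially on the quotient acts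
trivially — the mod-`p` shadow of `O8.not_bigIm` / `O8.image_hypotheses_fail`, for arbitrary `τ`.
[cite: Serre1972, §2.4 Prop. 15] -/
theorem O8.smul_eq_self_of_fix_line (hX : ClassX4 W p) (hns : ¬ Surj W p)
    {L : AddSubgroup (geomTorsion W (p : ℤ))} {τ : absoluteGaloisGroup ℚ}
    (hfix : ∀ P ∈ L, τ • P = P) (hquot : ∀ P, τ • P - P ∈ L) (Q : geomTorsion W (p : ℤ)) :
    τ • Q = Q :=
  smul_eq_self_of_fix_line_of_irr_of_not_surj W p hX.2.2 hns hfix hquot Q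

/-- **O8-TAME.** On an O8 pair, at any subgroup `I ≤ Γ_ℚ` where `E[p]` has the twisted-ordinary
shape `(1 ∗; 0 χ)`, `χ ≠ 1` (`TwistedOrdinaryLineAt W p I` — at `I = I_𝔓`, `𝔓 ∣ 3`, EVERY (M) and
`I₀*` row of O8: `E = E♭ ⊗ χ₋₃` with `E♭` multiplicative / good ordinary at `3`), `E[p]|_I ≅ χ ⊕ 1`
SPLITS (`InertiaSplitAt W p I`): the sub-partition key TAME of `class-closure/O8/STATEMENT.md` §12 /
`N11/SUBPARTITION-typed.md` v1.2 holds on ALL of O8's ordinary-type rows (census 244/244), as a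
theorem modulo the per-pair shape binder. So on these rows BOTH `p`-stabilisations of `ρ̄` exist and
the companion Hida family `H(ρ̄)` (trivial branch) has semistable members; the gap to a closed
semistable partner is exactly the unprinted line-switch law LS (`N11/TRANSPORT.md` v5). Nothing
booked; O8 OPEN. [cite: Serre1972, §2.4 Prop. 15]
[cite: Edixhoven1997Serre, §4.2 (PDF p. 297; companion forms)] -/
theorem O8.inertiaSplitAt_of_twistedOrdinaryLineAt (hX : ClassX4 W p) (hns : ¬ Surj W p)
    {I : Subgroup (absoluteGaloisGroup ℚ)} (hE : MixedCongruence.TwistedOrdinaryLineAt W p I) :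
    MixedCongruence.InertiaSplitAt W p I :=
  inertiaSplitAt_of_twistedOrdinaryLineAt_of_irr_of_not_surj W p hX.2.2 hns hE

/-- **O8: the inertia image is abelian on every ordinary-type row** (any `I ≤ Γ_ℚ` stabilising a
line of `E[p]`; in particular `I_𝔓` on the (M)/`I₀*` rows, where the fixed line is stable).
[cite: Serre1972, §2.4 Prop. 15] -/
theorem O8.smul_comm_of_stableLine (hX : ClassX4 W p) (hns : ¬ Surj W p)
    {I : Subgroup (absoluteGaloisGroup ℚ)} {L : AddSubgroup (geomTorsion W (p : ℤ))}
    (hL : Nat.card L = p) (hst : ∀ σ ∈ I, ∀ P ∈ L, σ • P ∈ L)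
    {τ τ' : absoluteGaloisGroup ℚ} (hτ : τ ∈ I) (hτ' : τ' ∈ I) (P : geomTorsion W (p : ℤ)) :
    τ • τ' • P = τ' • τ • P :=
  smul_comm_of_stableLine_of_irr_of_not_surj W p hX.2.2 hns hL hst hτ hτ' P

end Summit.BirchSwinnertonDyer.Rank1Residual.Additive

end
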